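import Summits.Ventures.CertifiedManyBodySolver.Downfold.EmeryShapeTrueCornerRule
import Summits.Ventures.CertifiedManyBodySolver.Downfold.EmeryFermiScalePointsTl1223IPK11TrueCorners
import Summits.Ventures.CertifiedManyBodySolver.Downfold.EmeryFermiScalePointsTl1223IPK11VirtualCorners
import HarnessLib

/-!
# THE ONE-BAND FERMI-SURFACE SHAPE `t′/t` OF THE WHOLE TYPED 3BE BOX `emeryBoxTl1223IPK11Src (EmeryBoxesKSlicesO)` AT ITS TWO TRUE CORNERS (true-corner rule under certified margins, §B.87 (i);
# router/EMERY-SHAPE-CORNERS.tsv «true» rows)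

Venture CertifiedManyBodySolver, cell `pub/hubbard-downfold` (stage S1; INFLATION-RULES-3to1-B §B.87 (i)), seat hubbard-downfold-mod-4 (technique B, g35); namespace
`Summit.Ventures.CertifiedManyBodySolver.Downfold.Emery`. Everything PROVED (0 sorry). WHAT THIS IS NOT: a statement about TlBa₂Ca₂Cu₃O₉ INNER plane ((K) source box) — the typed box is SCREENING-GRADE; `U = 0`
one-body kinematics of the σ model; object E = the EXACT `t–t′` shape of the σ Fermi surface at the row's own Fermi energy.

For EVERY one-body row of `[1.53, 2.29] × [1.18, 1.39] × [0.62, 0.73] × [0.15, 0.19]` eV the one-band `t′/t` lies between its values at the TRUE corners `(Δ₁, a₁, b₂, c₂)` and `(Δ₂, a₂, b₁, c₁)`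
(`EmeryShapeTrueCornerRule`; the t_pp / t_pp′ directions by the MARGIN LEVERS of `EmeryMarginLevers`, margins certified by `norm_num` with the constants `M` printed below), read
over their K = 384 brackets (`EmeryFermiScalePointsTl1223IPK11TrueCorners`).

| filling | **true-corner window (certified)** | margins (t_pp lower/upper; t_pp′ lower/upper) | two-ray (§B.86 (i)) | g19 sub-box device |
|---|---|---|---|---|
| n_H = 1.14 (ν = 43/100) | **[-0.3318, -0.2583]** | M_b 0.5559 / 2.4146; M_c 0.1431 / 0.0 | see EmeryBoxesTl1223IPK11ShapeCorners | [-0.3342,-0.2559] (n_H band) |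
| n_H = 1.18 (ν = 41/100) | **[-0.3317, -0.2586]** | M_b 0.5947 / 2.4549; M_c 0.0853 / 0.0 | see EmeryBoxesTl1223IPK11ShapeCorners | [-0.3342,-0.2559] (n_H band) |

Sources: three-band model [HybertsenSchluterChristensen1989, Eq. (1)]; [AndersenEtAl1995, §6]; box rows as cited in the typed object's file.
-/

noncomputable section

namespace Summit.Ventures.CertifiedManyBodySolver.Downfold.Emery

open Real Set

/-- **n_H = 1.14 (ν = 43/100): for every row of the box the one-band Fermi-surface `t′/t` (object E) lies in `[-0.3318, -0.2583]` — its values at the two TRUE corners** (margin levers; margins by `norm_num`). [folklore] -/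
theorem tl1223IPK11Box_fsRatio_true_nH114 {Δ a b c : ℝ} (hΔ : Δ ∈ Icc ((153 : ℝ) / 100) ((229 : ℝ) / 100)) (ha : a ∈ Icc ((59 : ℝ) / 50) ((139 : ℝ) / 100)) (hb : b ∈ Icc ((31 : ℝ) / 50) ((73 : ℝ) / 100)) (hc : c ∈ Icc ((3 : ℝ) / 20) ((19 : ℝ) / 100)) :
    fsRatio Δ a b c (fermiEnergyOf Δ a b c ((43 : ℝ) / 100)) ∈ Icc ((-1659 : ℝ) / 5000) ((-2583 : ℝ) / 10000) := by
  have hSL := (fermiEnergyOf_of_pointBracketCheck truePt_Tl1223IPK11SL_nH114_br (by norm_num) (by norm_num) (by norm_num) (ν := (43/100 : ℝ)) (by push_cast; exact ⟨le_rfl, le_rfl⟩)).2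
  have hTL := (fermiEnergyOf_of_pointBracketCheck truePt_Tl1223IPK11TL_nH114_br (by norm_num) (by norm_num) (by norm_num) (ν := (43/100 : ℝ)) (by push_cast; exact ⟨le_rfl, le_rfl⟩)).2
  have hSU := (fermiEnergyOf_of_pointBracketCheck truePt_Tl1223IPK11SU_nH114_br (by norm_num) (by norm_num) (by norm_num) (ν := (43/100 : ℝ)) (by push_cast; exact ⟨le_rfl, le_rfl⟩)).2
  have hQU := (fermiEnergyOf_of_pointBracketCheck truePt_Tl1223IPK11QU_nH114_br (by norm_num) (by norm_num) (by norm_num) (ν := (43/100 : ℝ)) (by push_cast; exact ⟨le_rfl, le_rfl⟩)).2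
  have hTH := (fermiEnergyOf_of_pointBracketCheck truePt_Tl1223IPK11TH_nH114_br (by norm_num) (by norm_num) (by norm_num) (ν := (43/100 : ℝ)) (by push_cast; exact ⟨le_rfl, le_rfl⟩)).2
  have hAlo := (fermiEnergyOf_of_pointBracketCheck virtPt_Tl1223IPK11Alo_nH114_br (by norm_num) (by norm_num) (by norm_num) (ν := (43/100 : ℝ)) (by push_cast; exact ⟨le_rfl, le_rfl⟩)).2
  have hTop := (fermiEnergyOf_of_pointBracketCheck virtPt_Tl1223IPK11H_nH114_br (by norm_num) (by norm_num) (by norm_num) (ν := (43/100 : ℝ)) (by push_cast; exact ⟨le_rfl, le_rfl⟩)).2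
  push_cast at hSL hTL hSU hQU hTH hAlo hTop
  norm_num at hSL hTL hSU hQU hTH hAlo hTop
  obtain ⟨hΔl, hΔu⟩ := hΔ
  obtain ⟨hal, hau⟩ := ha
  constructor
  · have hlow := fsRatio_fermiEnergyOf_trueCorner_lower (Δ₁ := ((153 : ℝ) / 100)) (a₁ := ((59 : ℝ) / 50)) (b₁ := ((31 : ℝ) / 50)) (b₂ := ((73 : ℝ) / 100)) (c₁ := ((3 : ℝ) / 20)) (c₂ := ((19 : ℝ) / 100))
      (ν := ((43 : ℝ) / 100)) (pL := ((799 : ℝ) / 500)) (qL := ((16841 : ℝ) / 10000)) (Mb := ((5559 : ℝ) / 10000)) (Mc := ((1431 : ℝ) / 10000)) (by norm_num) hΔl (by norm_num) hal (by norm_num) hb (by norm_num) hc (by norm_num) (by norm_num) (by norm_num)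
      (by norm_num) hSL.1 hAlo.2 (by norm_num) (by norm_num [fsD, fsN]) (by norm_num) (by norm_num) (by norm_num [fsD, fsN]) (by norm_num) (by norm_num [dopingDisc]) (by norm_num [fsD, fsN])
    refine le_trans ?_ hlow
    have hw := (fsRatio_mem_Icc_on_window_of_dopingDisc_nonneg (Δ := ((153 : ℝ) / 100)) (a := ((59 : ℝ) / 50)) (b := ((73 : ℝ) / 100)) (c := ((19 : ℝ) / 100))
      (p := ((16337 : ℝ) / 10000)) (q := ((16487 : ℝ) / 10000)) (by norm_num) (by norm_num) (by norm_num) (by norm_num) (by norm_num) (by norm_num) (by norm_num) (by norm_num [dopingDisc]) hTL).1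
    refine le_trans ?_ hw
    norm_num [fsRatio, fsD, fsN]
  · have hup := fsRatio_fermiEnergyOf_trueCorner_upper (Δ₁ := ((153 : ℝ) / 100)) (Δ₂ := ((229 : ℝ) / 100)) (a₁ := ((59 : ℝ) / 50)) (a₂ := ((139 : ℝ) / 100)) (b₁ := ((31 : ℝ) / 50)) (b₂ := ((73 : ℝ) / 100)) (c₁ := ((3 : ℝ) / 20)) (c₂ := ((19 : ℝ) / 100))
      (ν := ((43 : ℝ) / 100)) (pU := ((17219 : ℝ) / 10000)) (qU := ((1797 : ℝ) / 1000)) (qT := ((5159 : ℝ) / 2500)) (Mb := ((12073 : ℝ) / 5000)) (Mc := (0 : ℝ)) (by norm_num) ⟨hΔl, hΔu⟩ (by norm_num) ⟨hal, hau⟩ (by norm_num) hb (by norm_num) hc (by norm_num) (by norm_num) (by norm_num)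
      hTop.2 (by norm_num) (by norm_num) hSU.1 hQU.2 (by norm_num) (by norm_num [fsD, fsN]) (by norm_num) (by norm_num) (by norm_num [fsD, fsN]) (by norm_num) (by norm_num) (by norm_num [fsD, fsN])
    refine le_trans hup ?_
    have hw := (fsRatio_mem_Icc_on_window_of_dopingDisc_nonpos (Δ := ((229 : ℝ) / 100)) (a := ((139 : ℝ) / 100)) (b := ((31 : ℝ) / 50)) (c := ((3 : ℝ) / 20))
      (p := ((17553 : ℝ) / 10000)) (q := ((17653 : ℝ) / 10000)) (by norm_num) (by norm_num) (by norm_num) (by norm_num) (by norm_num) (by norm_num) (by norm_num) (by norm_num [dopingDisc]) hTH).2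
    refine le_trans hw ?_
    norm_num [fsRatio, fsD, fsN]

/-- **n_H = 1.18 (ν = 41/100): for every row of the box the one-band Fermi-surface `t′/t` (object E) lies in `[-0.3317, -0.2586]` — its values at the two TRUE corners** (margin levers; margins by `norm_num`). [folklore] -/
theorem tl1223IPK11Box_fsRatio_true_nH118 {Δ a b c : ℝ} (hΔ : Δ ∈ Icc ((153 : ℝ) / 100) ((229 : ℝ) / 100)) (ha : a ∈ Icc ((59 : ℝ) / 50) ((139 : ℝ) / 100)) (hb : b ∈ Icc ((31 : ℝ) / 50) ((73 : ℝ) / 100)) (hc : c ∈ Icc ((3 : ℝ) / 20) ((19 : ℝ) / 100)) :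
    fsRatio Δ a b c (fermiEnergyOf Δ a b c ((41 : ℝ) / 100)) ∈ Icc ((-3317 : ℝ) / 10000) ((-1293 : ℝ) / 5000) := by
  have hSL := (fermiEnergyOf_of_pointBracketCheck truePt_Tl1223IPK11SL_nH118_br (by norm_num) (by norm_num) (by norm_num) (ν := (41/100 : ℝ)) (by push_cast; exact ⟨le_rfl, le_rfl⟩)).2
  have hTL := (fermiEnergyOf_of_pointBracketCheck truePt_Tl1223IPK11TL_nH118_br (by norm_num) (by norm_num) (by norm_num) (ν := (41/100 : ℝ)) (by push_cast; exact ⟨le_rfl, le_rfl⟩)).2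
  have hSU := (fermiEnergyOf_of_pointBracketCheck truePt_Tl1223IPK11SU_nH118_br (by norm_num) (by norm_num) (by norm_num) (ν := (41/100 : ℝ)) (by push_cast; exact ⟨le_rfl, le_rfl⟩)).2
  have hQU := (fermiEnergyOf_of_pointBracketCheck truePt_Tl1223IPK11QU_nH118_br (by norm_num) (by norm_num) (by norm_num) (ν := (41/100 : ℝ)) (by push_cast; exact ⟨le_rfl, le_rfl⟩)).2
  have hTH := (fermiEnergyOf_of_pointBracketCheck truePt_Tl1223IPK11TH_nH118_br (by norm_num) (by norm_num) (by norm_num) (ν := (41/100 : ℝ)) (by push_cast; exact ⟨le_rfl, le_rfl⟩)).2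
  have hAlo := (fermiEnergyOf_of_pointBracketCheck virtPt_Tl1223IPK11Alo_nH118_br (by norm_num) (by norm_num) (by norm_num) (ν := (41/100 : ℝ)) (by push_cast; exact ⟨le_rfl, le_rfl⟩)).2
  have hTop := (fermiEnergyOf_of_pointBracketCheck virtPt_Tl1223IPK11H_nH118_br (by norm_num) (by norm_num) (by norm_num) (ν := (41/100 : ℝ)) (by push_cast; exact ⟨le_rfl, le_rfl⟩)).2
  push_cast at hSL hTL hSU hQU hTH hAlo hTop
  norm_num at hSL hTL hSU hQU hTH hAlo hTop
  obtain ⟨hΔl, hΔu⟩ := hΔ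
  obtain ⟨hal, hau⟩ := ha
  constructor
  · have hlow := fsRatio_fermiEnergyOf_trueCorner_lower (Δ₁ := ((153 : ℝ) / 100)) (a₁ := ((59 : ℝ) / 50)) (b₁ := ((31 : ℝ) / 50)) (b₂ := ((73 : ℝ) / 100)) (c₁ := ((3 : ℝ) / 20)) (c₂ := ((19 : ℝ) / 100))
      (ν := ((41 : ℝ) / 100)) (pL := ((779 : ℝ) / 500)) (qL := ((2049 : ℝ) / 1250)) (Mb := ((5947 : ℝ) / 10000)) (Mc := ((853 : ℝ) / 10000)) (by norm_num) hΔl (by norm_num) hal (by norm_num) hb (by norm_num) hc (by norm_num) (by norm_num) (by norm_num)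
      (by norm_num) hSL.1 hAlo.2 (by norm_num) (by norm_num [fsD, fsN]) (by norm_num) (by norm_num) (by norm_num [fsD, fsN]) (by norm_num) (by norm_num [dopingDisc]) (by norm_num [fsD, fsN])
    refine le_trans ?_ hlow
    have hw := (fsRatio_mem_Icc_on_window_of_dopingDisc_nonneg (Δ := ((153 : ℝ) / 100)) (a := ((59 : ℝ) / 50)) (b := ((73 : ℝ) / 100)) (c := ((19 : ℝ) / 100))
      (p := ((3177 : ℝ) / 2000)) (q := ((3207 : ℝ) / 2000)) (by norm_num) (by norm_num) (by norm_num) (by norm_num) (by norm_num) (by norm_num) (by norm_num) (by norm_num [dopingDisc]) hTL).1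
    refine le_trans ?_ hw
    norm_num [fsRatio, fsD, fsN]
  · have hup := fsRatio_fermiEnergyOf_trueCorner_upper (Δ₁ := ((153 : ℝ) / 100)) (Δ₂ := ((229 : ℝ) / 100)) (a₁ := ((59 : ℝ) / 50)) (a₂ := ((139 : ℝ) / 100)) (b₁ := ((31 : ℝ) / 50)) (b₂ := ((73 : ℝ) / 100)) (c₁ := ((3 : ℝ) / 20)) (c₂ := ((19 : ℝ) / 100))
      (ν := ((41 : ℝ) / 100)) (pU := ((16843 : ℝ) / 10000)) (qU := ((8777 : ℝ) / 5000)) (qT := ((4029 : ℝ) / 2000)) (Mb := ((24549 : ℝ) / 10000)) (Mc := (0 : ℝ)) (by norm_num) ⟨hΔl, hΔu⟩ (by norm_num) ⟨hal, hau⟩ (by norm_num) hb (by norm_num) hc (by norm_num) (by norm_num) (by norm_num)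
      hTop.2 (by norm_num) (by norm_num) hSU.1 hQU.2 (by norm_num) (by norm_num [fsD, fsN]) (by norm_num) (by norm_num) (by norm_num [fsD, fsN]) (by norm_num) (by norm_num) (by norm_num [fsD, fsN])
    refine le_trans hup ?_
    have hw := (fsRatio_mem_Icc_on_window_of_dopingDisc_nonpos (Δ := ((229 : ℝ) / 100)) (a := ((139 : ℝ) / 100)) (b := ((31 : ℝ) / 50)) (c := ((3 : ℝ) / 20))
      (p := ((1074 : ℝ) / 625)) (q := ((4321 : ℝ) / 2500)) (by norm_num) (by norm_num) (by norm_num) (by norm_num) (by norm_num) (by norm_num) (by norm_num) (by norm_num [dopingDisc]) hTH).2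
    refine le_trans hw ?_
    norm_num [fsRatio, fsD, fsN]

end Summit.Ventures.CertifiedManyBodySolver.Downfold.Emery
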